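import Summits.QuantumFields.BalabanUV.Beta.FP.TowerQN2RowJunction
import Summits.QuantumFields.BalabanUV.Beta.FP.KernelPeriodisationCopySums
import Summits.QuantumFields.BalabanUV.Beta.FP.TowerQN1Row

/-!
# `BalabanUV.Beta.FP.TowerQN2RowCopies` — road «FP», binder row D1, ROUTE T (β1), (E4e²) PART 3 (= `TowerQN2Row` §3 of an2 g67 A-2 l.67742): **THE ROAD's SIDE OF
# THE SECOND-ORDER 𝔔-JUNCTION IN THE SEAM CURRENCY** — F5-Sym's all-pairs-of-copies triple sum of leaf-02's packed sym family IS `perF T ∘ dper T` of its SECOND-BOND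
# COPY SUM read at the N slot `fN (x̄, κ₀)` (the finite-support letter from an2's windows `compVH2Ker_eq_zero_fluct ∕ _left ∕ _right`, the joint covariance from F5-Sym §1
# `packVH₂_translate` over `compVH2Ker_sh`, the bridge `KernelPeriodisationCopySums.tsum₃_translate_eq_perZ_dper_tsum`, the slot bridge #4 `perZ_dper_wrapPt_left`), hence
# **`(½•(𝔔′₂f (r•e_a) (r•e_{a′}) + sym)) (x̄,κ₀) (z,β) = (c²·r·r·Σ_full) · Σ_b Σ_{b′} colN̂_a b · (colN̂_{a′} b′ · perF T (dper T (X Z ↦ Σ' e, packVH (K₂ˢ (b.2, b.1)) (Lc^(n+2)) b′.2 (b′.1 + T∘e) X Z)) (fN (x̄,κ₀)) (z♭, β))`**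
# — v5's row `hQN₂`'s LEFT side in EXACTLY the product-against-`perF∘dper∘copy-sum` shape of an2's PART 14b right sides

WHY (`HOME/b2b-balaban-beta-d1-p3/g43/SPEC-55.md` §6; an2 g67 A-2 l.67742).  After this file the v5 row `hQN₂` at the road's data reads, entrywise,
`(c²·r·r·Σ_full) · Σ_b Σ_{b′} colN̂ colN̂ · Ŵˢ_{b,b′}` on the left and (an2's PART 14b and sequels, sector by sector) `Σ_b Σ_{b′} colN̂ colN̂ · Ŵ^{WN}_{b,b′}` on the right, both
`Ŵ` being `perF T (dper T (second-bond copy sum of a two-bond table at (b, b′)))` at the same slots — what remains is the (C1) TABLE WORD at order 2 (an2's: which tables of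
`W2SymOfK (AN R j) …` sit against `compVH2Ker ℓˢ 𝓋ˢ 𝓋₂ˢ`'s summands) and the second-order LOCK ROWS it fixes (SPEC-54 §5), displayed then.
WHAT ([folklore] `Set.Finite`∕`tsum` bookkeeping BY NAME; no `def`, no `def … : Prop`, nothing cited, 0 sorry):
§1 generic (`d`): `finite_setOf_mem_winF`, **`finite_support_copies_packVH`** (road `PeriodisedBorderTables.translate_eq_add_smul` reused — v1.1, leaf-03 g59 HOLD-1 l.67754) — for a three-bond kernel `K μ y f b b′` supported in an2's windows (`f.2, b.2, b′.2 ∈ winF L′ W y`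
whenever `K ≠ 0`, displayed as `hK`) and a torus `T = L·M`, the copy family `(k,n,j) ↦ packVH (K · · · (κ₁,b₁) ·) L κ₂ (b₂+T∘n) (X+T∘k) ((Z+T∘j)+T∘k) (inr κ₀) (inl β)` is
FINITELY SUPPORTED (the coarse sites whose window contains `b₁` form a finite set `Y`; `k ↦ blk L X + M∘k` is injective; `n`, `j` range in preimages of `⋃_{y∈Y} winF y`
under injective translations); §2 at the record's sym packed family (`d = 3`, `L = L′ = Lc^(n+2)`, `W = wid Lc (n+2)`, `T = towerTorus Lc (fine Lc M) (n+1)`):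
`sym_packVH_windows` (the `hK` letter from `compVH2Ker_eq_zero_*`), `sym_packVH_copies_covariant` (the bridge's `hW` from `packVH₂_translate`), **`tsum₃_sym_packVH_eq_perF_dper_tsum`**,
**`Qprime2_symm_apply_eq_sum_sum_perF_dper_copies`** (the displayed formula; (F) §2 + the above + `hfN`).
NOT HERE: the table word ∕ lock rows (an2), `hQN2_of_road_data` (the sequel `TowerQN2Row`, consuming an2's sector folds BY NAME).  Nothing of Bałaban's asserted, valued or
discharged; 0 estimates; 0∕4 row-D1 binders (hW, hR, D1Tel, D1Rep); NOT (C1), NOT `hQN₂`, NOT (T-ID), NOT D1, NEVER «G-an2-4 closed», NOT BetaPertH, NOT continuum, NOT Clay.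

HONEST DEPENDENCY (page 1, mandatory): continuum YM on T⁴ ⇐ BetaPertH ∧ nine spine estimates (0/9 proved); BetaPertH ⇐ (D1) ∧ (D4) ∧ CAP+tail;
G-an2-4 gates asym, D1 and NE2/3/4.  HONEST FRAMING (cell contract, verbatim): «discharging `BetaPertH` makes Bałaban's UV stability UNCONDITIONAL —
a real constructive-QFT result; it is NOT the continuum limit and NOT the Clay problem.»  ABSOLUTE RULE (cell charter, verbatim): «No internally-minted
statement may enter as a cited fact. Every hypothesis is either kernel-proved in this package or a verbatim quotation of a PUBLISHED theorem with page
reference. The manuscript(s) under audit are NOT citable for their own disputed steps — they are the thing under adjudication; programme-internal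
(2001/route/tribunal) claims are never citable.»  Road «FP» OWNER, b2b-balaban-beta-d1-p3 gen 43, 2026-08-27.  No existing file touched.
-/

noncomputable section

open scoped BigOperators

namespace Summit.QuantumFields.BalabanUV.Beta.FP.TowerQN2RowCopies

open Finset Matrix
open Literature.MathematicalPhysics.QuantumFieldTheory
open Literature.MathematicalPhysics.QuantumFieldTheory.Balaban1983to89
open Literature.MathematicalPhysics.QuantumFieldTheory.Balaban1983to89.Beta
open B4TorusKernel.MultiPeriod (translate translate_injective)
open B4Reflection242 (translate_translate)
open B5Prop11Plancherel (fine)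
open B6Lemma24Torus (pbox)
open AffineAveraging (Site box toSite)
open AveragingContours (off blk)
open AveragingContoursRooted (ctr ctrOff)
open AveragingHessianKernels (Bond packVH packVH_inr_inl off_add_smul blk_add_smul)
open ExpKernelCalculus (MKer shiftK)
open OneStepResolventKernel (Fib)
open Summit.QuantumFields.BalabanUV.Beta.BorderedHessian (stepScale)
open Summit.QuantumFields.BalabanUV.Beta.SymAveragingHessianCounts (symLinKerAt symVhKerAt symLinKerAt_add symVhKerAt_add)
open Summit.QuantumFields.BalabanUV.Beta.SymAveragingMixedJetTables (symVh2KerAt symVh2KerAt_add)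
open Summit.QuantumFields.BalabanUV.Beta.CompositeVertexKernelRec (winF wid mem_winF_iff compVH2Ker compVH2Ker_sh compVH2Ker_eq_zero_fluct
  compVH2Ker_eq_zero_left compVH2Ker_eq_zero_right)
open Summit.QuantumFields.BalabanUV.Beta.CompositeOneShotJetData (Roots AN)
open Summit.QuantumFields.BalabanUV.Beta.FP.KernelPeriodisationFib (Idx perF perZ perF_apply)
open Summit.QuantumFields.BalabanUV.Beta.FP.KernelPeriodisationFibLoc (dper)
open Summit.QuantumFields.BalabanUV.Beta.FP.KernelPeriodisationCopySums (tsum₃_translate_eq_perZ_dper_tsum)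
open Summit.QuantumFields.BalabanUV.Beta.FP.TorusGaugeCovariance (tgrad)
open Summit.QuantumFields.BalabanUV.Beta.FP.TorusGaugeCovariancePairing (wrapPt)
open Summit.QuantumFields.BalabanUV.Beta.FP.TorusCompositeObjects (towerTorus towerTorus_succ towerTorus_apply)
open Summit.QuantumFields.BalabanUV.Beta.FP.TorusCompositeCovariance (itRoot)
open Summit.QuantumFields.BalabanUV.Beta.FP.TorusCompositeObjectsG (compRowsSym)
open Summit.QuantumFields.BalabanUV.Beta.FP.TorusCompositeCovarianceOneSym (compIns₁Sym)
open Summit.QuantumFields.BalabanUV.Beta.FP.TorusCompositeCovarianceTwoPolarSym (compIns₂₂Sym)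
open Summit.QuantumFields.BalabanUV.Beta.FP.TorusCompositeVertexJunctionTwoSym (packVH₂_translate)
open Summit.QuantumFields.BalabanUV.Beta.FP.TowerQN1Row (perZ_dper_wrapPt_left)
open Summit.QuantumFields.BalabanUV.Beta.FP.PeriodisedBorderTables (translate_eq_add_smul)
open Summit.QuantumFields.BalabanUV.Beta.FP.TowerQN2RowJunction (Qprime2_symm_apply_eq_sigmaFull_mul_sum_sum)

variable {d : ℕ}

/-! ## §1 The finite-support letter for the copy family of a windowed packed two-bond kernel -/

section Finite

/-- [folklore] the coarse sites whose scale-`L′`, width-`W` window contains a fixed site form a finite set. -/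
theorem finite_setOf_mem_winF {L' : ℕ} (hL' : 1 ≤ L') (W : ℕ) (b₁ : Fin (d + 1) → ℤ) :
    {y : Fin (d + 1) → ℤ | b₁ ∈ winF L' W y}.Finite := by
  classical
  refine (Fintype.piFinset fun i => Finset.Icc (-(|b₁ i| + (W : ℤ))) (|b₁ i| + (W : ℤ))).finite_toSet.subset fun y hy => ?_
  rw [Finset.mem_coe, Fintype.mem_piFinset]
  intro i
  rw [Finset.mem_Icc]
  have h := (mem_winF_iff.1 hy) i
  have hL1 : (1 : ℤ) ≤ L' := by exact_mod_cast hL'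
  have hb := le_abs_self (b₁ i)
  have hb' := neg_abs_le (b₁ i)
  have hW : (0 : ℤ) ≤ W := by positivity
  rcases le_or_gt 0 (y i) with hy0 | hy0
  · constructor
    · linarith
    · nlinarith [h.1]
  · constructor
    · nlinarith [h.2]
    · linarith

/-- [folklore] **`finite_support_copies_packVH` — THE FINITE-SUPPORT LETTER.**  A three-bond kernel `K μ y f b b′` vanishing unless `f.2, b.2, b′.2 ∈ winF L′ W y` (an2's
composite windows), packed at scale `L` and read on a torus `T = L·M` along the copy family of the second-order junction: for fixed `b₁ b₂ X Z` the family
`(k, n, j) ↦ packVH (K · · · (κ₁,b₁) ·) L κ₂ (b₂+T∘n) (X+T∘k) ((Z+T∘j)+T∘k) (inr κ₀) (inl β)` has finite support. -/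
theorem finite_support_copies_packVH {L L' W : ℕ} (hL : 1 ≤ L) (hL' : 1 ≤ L') {M T : Fin (d + 1) → ℕ} (hM : ∀ i, 1 ≤ M i) (hT : ∀ i, T i = L * M i)
    (K : Fin (d + 1) → (Fin (d + 1) → ℤ) → Bond (d + 1) → Bond (d + 1) → Bond (d + 1) → ℝ)
    (hK : ∀ μ y f b b', K μ y f b b' ≠ 0 → f.2 ∈ winF L' W y ∧ b.2 ∈ winF L' W y ∧ b'.2 ∈ winF L' W y)
    (κ₁ κ₂ κ₀ β : Fin (d + 1)) (b₁ b₂ X Z : Fin (d + 1) → ℤ) :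
    (Function.support fun p : (Fin (d + 1) → ℤ) × ((Fin (d + 1) → ℤ) × (Fin (d + 1) → ℤ)) =>
      packVH (fun μ y f f' => K μ y f (κ₁, b₁) f') L κ₂ (translate T b₂ p.2.1)
        (translate T X p.1) (translate T (translate T Z p.2.2) p.1) (Sum.inr κ₀) (Sum.inl β)).Finite := by
  classical
  have hT1 : ∀ i, 1 ≤ T i := fun i => by rw [hT i]; exact Nat.mul_pos hL (hM i)
  by_cases hoff : off L X = 0
  · -- the finite set of admissible coarse sites, and the three finite index sets
    have hY : {y : Fin (d + 1) → ℤ | b₁ ∈ winF L' W y}.Finite := finite_setOf_mem_winF hL' W b₁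
    set g : (Fin (d + 1) → ℤ) → (Fin (d + 1) → ℤ) := fun k => blk L X + fun i => (M i : ℤ) * k i with hg
    have hginj : Function.Injective g := by
      intro k k' h
      funext i
      have hi := congrFun h i
      simp only [hg, Pi.add_apply, add_right_inj] at hi
      have hMi : (M i : ℤ) ≠ 0 := by have := hM i; positivity
      exact mul_left_cancel₀ hMi hi
    have hSk : (g ⁻¹' {y : Fin (d + 1) → ℤ | b₁ ∈ winF L' W y}).Finite := hY.preimage hginj.injOn
    set U : Set (Fin (d + 1) → ℤ) := ⋃ y ∈ {y : Fin (d + 1) → ℤ | b₁ ∈ winF L' W y}, (↑(winF L' W y) : Set (Fin (d + 1) → ℤ)) with hU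
    have hUf : U.Finite := hY.biUnion fun y _ => (winF L' W y).finite_toSet
    have hSn : ((translate T b₂) ⁻¹' U).Finite := hUf.preimage (translate_injective hT1 b₂).injOn
    have hjinj : ∀ k : Fin (d + 1) → ℤ, Function.Injective fun j : Fin (d + 1) → ℤ => translate T (translate T Z j) k := by
      intro k j j' h
      have h' : translate T Z (j + k) = translate T Z (j' + k) := by simpa only [translate_translate] using h
      exact add_right_cancel (translate_injective hT1 Z h')
    have hSj : (⋃ k ∈ g ⁻¹' {y : Fin (d + 1) → ℤ | b₁ ∈ winF L' W y},
        (fun j : Fin (d + 1) → ℤ => translate T (translate T Z j) k) ⁻¹' U).Finite :=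
      hSk.biUnion fun k _ => hUf.preimage (hjinj k).injOn
    refine (hSk.prod (hSn.prod hSj)).subset ?_
    rintro ⟨k, n, j⟩ hp
    rw [Function.mem_support, packVH_inr_inl, translate_eq_add_smul hT X k, off_add_smul, blk_add_smul hL, if_pos hoff] at hp
    obtain ⟨hf, hb, hb'⟩ := hK _ _ _ _ _ hp
    have hk : k ∈ g ⁻¹' {y : Fin (d + 1) → ℤ | b₁ ∈ winF L' W y} := hb
    have hn : translate T b₂ n ∈ U := Set.mem_biUnion hk hb'
    have hj : translate T (translate T Z j) k ∈ U := Set.mem_biUnion hk hf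
    exact Set.mk_mem_prod hk (Set.mk_mem_prod hn (Set.mem_biUnion hk hj))
  · -- off the coarse lattice every copy term vanishes
    refine Set.finite_empty.subset ?_
    rintro ⟨k, n, j⟩ hp
    rw [Function.mem_support, packVH_inr_inl, translate_eq_add_smul hT X k, off_add_smul, if_neg hoff] at hp
    exact (hp rfl).elim

end Finite

/-! ## §2 At the record's sym packed family: windows, covariance, the bridge at the N slot, and v5's `hQN₂` left side in the seam currency -/

section Record

variable {Lc : ℕ} [NeZero Lc] (M : Fin (3 + 1) → ℕ) [∀ μ, NeZero (M μ)] (n : ℕ) (c : ℝ)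

omit [NeZero Lc] in
/-- [folklore] the windows letter of an2's sym composite second-order kernel (`compVH2Ker_eq_zero_fluct ∕ _left ∕ _right`, contraposed). -/
theorem sym_packVH_windows (μ : Fin (3 + 1)) (y : Site (3 + 1)) (f b b' : Bond (3 + 1))
    (h : compVH2Ker (fun _ : ℕ => symLinKerAt (ctr (3 + 1) Lc) Lc) (fun _ : ℕ => symVhKerAt (ctr (3 + 1) Lc) Lc)
      (fun (_ : ℕ) μ y g g₁ g₂ => (1 / 2 : ℝ) * (symVh2KerAt (ctr (3 + 1) Lc) Lc μ y g g₁ g₂ + symVh2KerAt (ctr (3 + 1) Lc) Lc μ y g g₂ g₁)) Lc (n + 1 + 1) μ y f b b' ≠ 0) :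
    f.2 ∈ winF (Lc ^ (n + 1 + 1)) (wid Lc (n + 1 + 1)) y ∧ b.2 ∈ winF (Lc ^ (n + 1 + 1)) (wid Lc (n + 1 + 1)) y ∧ b'.2 ∈ winF (Lc ^ (n + 1 + 1)) (wid Lc (n + 1 + 1)) y := by
  refine ⟨?_, ?_, ?_⟩
  · by_contra hc; exact h (compVH2Ker_eq_zero_fluct (n + 1 + 1) b b' hc)
  · by_contra hc; exact h (compVH2Ker_eq_zero_left (n + 1 + 1) f b' hc)
  · by_contra hc; exact h (compVH2Ker_eq_zero_right (n + 1 + 1) f b hc)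

omit [NeZero Lc] [∀ μ, NeZero (M μ)] in
/-- [folklore] the periods of the finest torus: `towerTorus Lc (fine Lc M) (n+1) i = Lc^(n+2) · M i`. -/
theorem towerTorus_fine_apply (i : Fin (3 + 1)) : towerTorus Lc (fine Lc M) (n + 1) i = Lc ^ (n + 1 + 1) * M i := by
  rw [← towerTorus_succ, towerTorus_apply]

omit [∀ μ, NeZero (M μ)] in
/-- [folklore] **the bridge's covariance letter for the sym packed family** (F5-Sym §1 `packVH₂_translate` over an2's `compVH2Ker_sh` at an1's `symLinKerAt_add ∕ symVhKerAt_add ∕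
symVh2KerAt_add`, read on the torus `T = Lc^(n+2)·M`). -/
theorem sym_packVH_copies_covariant (κ κ' : Fin (3 + 1)) (t u u' X Z : Site (3 + 1)) (a e : Fib 3) :
    packVH (fun μ y f f' => compVH2Ker (fun _ : ℕ => symLinKerAt (ctr (3 + 1) Lc) Lc) (fun _ : ℕ => symVhKerAt (ctr (3 + 1) Lc) Lc)
        (fun (_ : ℕ) μ y g g₁ g₂ => (1 / 2 : ℝ) * (symVh2KerAt (ctr (3 + 1) Lc) Lc μ y g g₁ g₂ + symVh2KerAt (ctr (3 + 1) Lc) Lc μ y g g₂ g₁)) Lc (n + 1 + 1) μ y f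
        (κ, translate (towerTorus Lc (fine Lc M) (n + 1)) u t) f') (Lc ^ (n + 1 + 1)) κ' (translate (towerTorus Lc (fine Lc M) (n + 1)) u' t)
        (translate (towerTorus Lc (fine Lc M) (n + 1)) X t) (translate (towerTorus Lc (fine Lc M) (n + 1)) Z t) a e
      = packVH (fun μ y f f' => compVH2Ker (fun _ : ℕ => symLinKerAt (ctr (3 + 1) Lc) Lc) (fun _ : ℕ => symVhKerAt (ctr (3 + 1) Lc) Lc)
        (fun (_ : ℕ) μ y g g₁ g₂ => (1 / 2 : ℝ) * (symVh2KerAt (ctr (3 + 1) Lc) Lc μ y g g₁ g₂ + symVh2KerAt (ctr (3 + 1) Lc) Lc μ y g g₂ g₁)) Lc (n + 1 + 1) μ y f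
        (κ, u) f') (Lc ^ (n + 1 + 1)) κ' u' X Z a e := by
  have hLn : 1 ≤ Lc ^ (n + 1 + 1) := Nat.one_le_pow _ _ (Nat.one_le_iff_ne_zero.mpr (NeZero.ne Lc))
  have hT : ∀ i, towerTorus Lc (fine Lc M) (n + 1) i = Lc ^ (n + 1 + 1) * M i := towerTorus_fine_apply M n
  have key := packVH₂_translate hLn
    (compVH2Ker (fun _ : ℕ => symLinKerAt (ctr (3 + 1) Lc) Lc) (fun _ : ℕ => symVhKerAt (ctr (3 + 1) Lc) Lc)
      (fun (_ : ℕ) μ y g g₁ g₂ => (1 / 2 : ℝ) * (symVh2KerAt (ctr (3 + 1) Lc) Lc μ y g g₁ g₂ + symVh2KerAt (ctr (3 + 1) Lc) Lc μ y g g₂ g₁)) Lc (n + 1 + 1))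
    (fun μ y t f g g' => by
      rw [Nat.cast_pow]
      exact compVH2Ker_sh (fun _ μ y t f => symLinKerAt_add (ctr (3 + 1) Lc) Lc μ y t f) (fun _ μ y t f f' => symVhKerAt_add (ctr (3 + 1) Lc) Lc μ y t f f')
        (fun _ μ y t g g' g'' => by simp only [symVh2KerAt_add]) (n + 1 + 1) f g g' μ y t)
    κ u κ' u' (fun i => (M i : ℤ) * t i)
  rw [translate_eq_add_smul hT u t, translate_eq_add_smul hT u' t, translate_eq_add_smul hT X t, translate_eq_add_smul hT Z t, key]
  simp only [shiftK, add_neg_cancel_right]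

variable (fN : (↥(pbox M) × Fin (3 + 1)) → Idx (towerTorus Lc (fine Lc M) (n + 1)) (Fib 3))
  (hfN : ∀ a : ↥(pbox M) × Fin (3 + 1),
    fN a = (wrapPt (towerTorus Lc (fine Lc M) (n + 1)) (((Lc ^ (n + 1 + 1) : ℕ) : ℤ) • (a.1 : Site (3 + 1))), Sum.inr a.2))

include hfN in
/-- [folklore] **`tsum₃_sym_packVH_eq_perF_dper_tsum` — F5-Sym's TRIPLE COPY SUM IS `perF T ∘ dper T` OF THE SECOND-BOND COPY SUM, READ AT THE N SLOT** (§1's finite-support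
letter + `sym_packVH_copies_covariant` into `KernelPeriodisationCopySums.tsum₃_translate_eq_perZ_dper_tsum`; then #4's slot bridge `perZ_dper_wrapPt_left` and `hfN`). -/
theorem tsum₃_sym_packVH_eq_perF_dper_tsum (b b' : ↥(pbox (towerTorus Lc (fine Lc M) (n + 1))) × Fin (3 + 1))
    (x : ↥(pbox M)) (κ₀ : Fin (3 + 1)) (z : ↥(pbox (towerTorus Lc (fine Lc M) (n + 1)))) (β : Fin (3 + 1)) :
    (∑' m₁ : Site (3 + 1), ∑' m₂ : Site (3 + 1), ∑' m : Site (3 + 1),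
      packVH (fun μ y f f' => compVH2Ker (fun _ : ℕ => symLinKerAt (ctr (3 + 1) Lc) Lc) (fun _ : ℕ => symVhKerAt (ctr (3 + 1) Lc) Lc)
        (fun (_ : ℕ) μ y g g₁ g₂ => (1 / 2 : ℝ) * (symVh2KerAt (ctr (3 + 1) Lc) Lc μ y g g₁ g₂ + symVh2KerAt (ctr (3 + 1) Lc) Lc μ y g g₂ g₁)) Lc (n + 1 + 1) μ y f
          (b.2, translate (towerTorus Lc (fine Lc M) (n + 1)) (b.1 : Site (3 + 1)) m₁) f') (Lc ^ (n + 1 + 1)) b'.2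
          (translate (towerTorus Lc (fine Lc M) (n + 1)) (b'.1 : Site (3 + 1)) m₂)
        ((((Lc ^ (n + 1 + 1) : ℕ) : ℤ)) • (x : Site (3 + 1))) (translate (towerTorus Lc (fine Lc M) (n + 1)) (z : Site (3 + 1)) m) (Sum.inr κ₀) (Sum.inl β))
      = perF (towerTorus Lc (fine Lc M) (n + 1)) (dper (towerTorus Lc (fine Lc M) (n + 1)) (fun X Z a e => ∑' m₂ : Site (3 + 1),
          packVH (fun μ y f f' => compVH2Ker (fun _ : ℕ => symLinKerAt (ctr (3 + 1) Lc) Lc) (fun _ : ℕ => symVhKerAt (ctr (3 + 1) Lc) Lc)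
            (fun (_ : ℕ) μ y g g₁ g₂ => (1 / 2 : ℝ) * (symVh2KerAt (ctr (3 + 1) Lc) Lc μ y g g₁ g₂ + symVh2KerAt (ctr (3 + 1) Lc) Lc μ y g g₂ g₁)) Lc (n + 1 + 1) μ y f
              (b.2, (b.1 : Site (3 + 1))) f') (Lc ^ (n + 1 + 1)) b'.2 (translate (towerTorus Lc (fine Lc M) (n + 1)) (b'.1 : Site (3 + 1)) m₂) X Z a e))
        (fN (x, κ₀)) ((z, Sum.inl β) : Idx (towerTorus Lc (fine Lc M) (n + 1)) (Fib 3)) := by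
  have hL : 1 ≤ Lc ^ (n + 1 + 1) := Nat.one_le_pow _ _ (Nat.one_le_iff_ne_zero.mpr (NeZero.ne Lc))
  have hM1 : ∀ i, 1 ≤ M i := fun i => Nat.one_le_iff_ne_zero.mpr (NeZero.ne (M i))
  have hT : ∀ i, towerTorus Lc (fine Lc M) (n + 1) i = Lc ^ (n + 1 + 1) * M i := towerTorus_fine_apply M n
  -- the bridge, with the finite-support and covariance letters of the sym packed family
  rw [tsum₃_translate_eq_perZ_dper_tsum (towerTorus Lc (fine Lc M) (n + 1))
      (fun u u' => packVH (fun μ y f f' => compVH2Ker (fun _ : ℕ => symLinKerAt (ctr (3 + 1) Lc) Lc) (fun _ : ℕ => symVhKerAt (ctr (3 + 1) Lc) Lc)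
        (fun (_ : ℕ) μ y g g₁ g₂ => (1 / 2 : ℝ) * (symVh2KerAt (ctr (3 + 1) Lc) Lc μ y g g₁ g₂ + symVh2KerAt (ctr (3 + 1) Lc) Lc μ y g g₂ g₁)) Lc (n + 1 + 1) μ y f
          (b.2, u) f') (Lc ^ (n + 1 + 1)) b'.2 u')
      (fun t u u' X Z a e => sym_packVH_copies_covariant M n b.2 b'.2 t u u' X Z a e)
      (b.1 : Site (3 + 1)) (b'.1 : Site (3 + 1)) _ (z : Site (3 + 1)) (Sum.inr κ₀) (Sum.inl β)
      (finite_support_copies_packVH hL hL hM1 hT _ (fun μ y f b₀ b₀' h => sym_packVH_windows n μ y f b₀ b₀' h) b.2 b'.2 κ₀ β _ _ _ _)]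
  -- the slot bridge
  rw [perF_apply, hfN (x, κ₀)]
  exact (perZ_dper_wrapPt_left (towerTorus Lc (fine Lc M) (n + 1)) _ _ _ _ _).symm

variable (hc : ctrOff (3 + 1) Lc ∈ box (3 + 1) Lc)
  {κ : Type*} [Fintype κ] [DecidableEq κ] (yN : κ → Site (3 + 1)) (μN : κ → Fin (3 + 1))
  (hv : (κ → ℝ) → (↥(pbox (towerTorus Lc (fine Lc M) (n + 1))) × Fin (3 + 1) → ℝ))
  (hhvl : ∀ (r : ℝ) (x y : κ → ℝ), hv (r • x + y) = r • hv x + hv y)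
  (lv : (κ → ℝ) → ↥(pbox (towerTorus Lc (fine Lc M) (n + 1))) → ℝ)
  (hlv : ∀ (r : ℝ) (x y : κ → ℝ), lv (r • x + y) = r • lv x + lv y)
  (hJW : ∀ (a : κ) (b : ↥(pbox (towerTorus Lc (fine Lc M) (n + 1))) × Fin (3 + 1)), hv (Pi.single a 1) b
      = perF (towerTorus Lc (fine Lc M) (n + 1)) (AN (Roots.ctr Lc) (n + 1)) (b.1, Sum.inl b.2)
          (wrapPt (towerTorus Lc (fine Lc M) (n + 1)) (((Lc ^ (n + 1 + 1) : ℕ) : ℤ) • yN a), Sum.inr (μN a))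
        - ∑ s : ↥(pbox (towerTorus Lc (fine Lc M) (n + 1))), tgrad (towerTorus Lc (fine Lc M) (n + 1)) (b.1, Sum.inl b.2) s * lv (Pi.single a 1) s)
  (𝔔₀ : Matrix ((↥(pbox M) × Fin (3 + 1))) (↥(pbox (towerTorus Lc (fine Lc M) (n + 1))) × Fin (3 + 1)) ℝ)
  (h𝔔₀' : 𝔔₀ = (compRowsSym Lc M (fun i : ℕ => n + 1 - (i - 1)) (fun _ : ℕ => ctrOff (3 + 1) Lc) (n + 1 + 1) :
      Matrix ((↥(pbox M) × Fin (3 + 1))) (↥(pbox (towerTorus Lc (fine Lc M) (n + 1))) × Fin (3 + 1)) ℝ))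
  (𝔔₁f : (κ → ℝ) → Matrix ((↥(pbox M) × Fin (3 + 1))) (↥(pbox (towerTorus Lc (fine Lc M) (n + 1))) × Fin (3 + 1)) ℝ)
  (h𝔔₁' : ∀ v, 𝔔₁f v = c • compIns₁Sym Lc M (fun i : ℕ => n + 1 - (i - 1)) (fun _ : ℕ => ctrOff (3 + 1) Lc) (n + 1 + 1) (hv v))
  (𝔔₂f : (κ → ℝ) → (κ → ℝ) → Matrix ((↥(pbox M) × Fin (3 + 1))) (↥(pbox (towerTorus Lc (fine Lc M) (n + 1))) × Fin (3 + 1)) ℝ)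
  (h𝔔₂' : ∀ v v', (1 / 2 : ℝ) • (𝔔₂f v v' + 𝔔₂f v' v)
    = c ^ 2 • compIns₂₂Sym Lc M (fun i : ℕ => n + 1 - (i - 1)) (fun _ : ℕ => ctrOff (3 + 1) Lc) (n + 1 + 1) (hv v) (hv v'))
  (Xbf : (κ → ℝ) → Matrix ((↥(pbox M) × Fin (3 + 1))) ((↥(pbox M) × Fin (3 + 1))) ℝ)
  (hXbf : ∀ v, Xbf v = c • Matrix.diagonal (fun a : (↥(pbox M) × Fin (3 + 1)) =>
    lv v (itRoot Lc M (fun _ : ℕ => ctrOff (3 + 1) Lc) (fun _ => hc) (n + 1 + 1) a.1)))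
  (𝔔'₂f : (κ → ℝ) → (κ → ℝ) → Matrix ((↥(pbox M) × Fin (3 + 1))) (↥(pbox (towerTorus Lc (fine Lc M) (n + 1))) × Fin (3 + 1)) ℝ)
  (h𝔔'₂f : ∀ v v', 𝔔'₂f v v' = Xbf v * Xbf v' * 𝔔₀ + (Xbf v * 𝔔₁f v' + Xbf v * 𝔔₀ * (-(c • Matrix.diagonal (fun b : (↥(pbox (towerTorus Lc (fine Lc M) (n + 1))) × Fin (3 + 1)) => lv v' b.1))))
      + ((Xbf v * 𝔔₁f v' + Xbf v * 𝔔₀ * (-(c • Matrix.diagonal (fun b : (↥(pbox (towerTorus Lc (fine Lc M) (n + 1))) × Fin (3 + 1)) => lv v' b.1)))) + (𝔔₂f v v' + 𝔔₁f v * (-(c • Matrix.diagonal (fun b : (↥(pbox (towerTorus Lc (fine Lc M) (n + 1))) × Fin (3 + 1)) => lv v' b.1))) + (𝔔₁f v * (-(c • Matrix.diagonal (fun b : (↥(pbox (towerTorus Lc (fine Lc M) (n + 1))) × Fin (3 + 1)) => lv v' b.1))) + 𝔔₀ * ((-(c • Matrix.diagonal (fun b : (↥(pbox (towerTorus Lc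 (fine Lc M) (n + 1))) × Fin (3 + 1)) => lv v b.1))) * (-(c • Matrix.diagonal (fun b : (↥(pbox (towerTorus Lc (fine Lc M) (n + 1))) × Fin (3 + 1)) => lv v' b.1))))))))
  (r : ℝ) (a a' : κ)

omit [Fintype κ] in
include hfN hhvl hlv hJW h𝔔₀' h𝔔₁' h𝔔₂' hXbf h𝔔'₂f in
/-- [folklore] **`Qprime2_symm_apply_eq_sum_sum_perF_dper_copies` — v5's ROW `hQN₂`'s LEFT SIDE IN THE SEAM CURRENCY**: for #6's letters and the slot map `fN`,
`(½•(𝔔′₂f (r•e_a) (r•e_{a′}) + 𝔔′₂f (r•e_{a′}) (r•e_a))) (x̄,κ₀) (z,β) = (c²·r·r·Σ_full) · Σ_b Σ_{b′} colN̂_a b · (colN̂_{a′} b′ · perF T (dper T (X Z ↦ Σ' e, packVH (K₂ˢ (b.2, b.1)) (Lc^(n+2)) b′.2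
(b′.1 + T∘e) X Z)) (fN (x̄,κ₀)) (z♭, β))` ((F) §2 + `tsum₃_sym_packVH_eq_perF_dper_tsum` termwise). -/
theorem Qprime2_symm_apply_eq_sum_sum_perF_dper_copies
    (x : ↥(pbox M)) (κ₀ : Fin (3 + 1)) (z : ↥(pbox (towerTorus Lc (fine Lc M) (n + 1)))) (β : Fin (3 + 1)) :
    ((1 / 2 : ℝ) • (𝔔'₂f (r • (Pi.single a (1 : ℝ) : κ → ℝ)) (r • (Pi.single a' (1 : ℝ) : κ → ℝ))
        + 𝔔'₂f (r • (Pi.single a' (1 : ℝ) : κ → ℝ)) (r • (Pi.single a (1 : ℝ) : κ → ℝ)))) (x, κ₀) (z, β)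
      = (c ^ 2 * r * r * ∏ ℓ ∈ range (n + 1 + 1), (stepScale 3 Lc ℓ * ((box (3 + 1) Lc).card : ℝ))) *
          ∑ b : ↥(pbox (towerTorus Lc (fine Lc M) (n + 1))) × Fin (3 + 1), ∑ b' : ↥(pbox (towerTorus Lc (fine Lc M) (n + 1))) × Fin (3 + 1),
            perF (towerTorus Lc (fine Lc M) (n + 1)) (AN (Roots.ctr Lc) (n + 1)) (b.1, Sum.inl b.2)
                (wrapPt (towerTorus Lc (fine Lc M) (n + 1)) (((Lc ^ (n + 1 + 1) : ℕ) : ℤ) • yN a), Sum.inr (μN a)) *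
              (perF (towerTorus Lc (fine Lc M) (n + 1)) (AN (Roots.ctr Lc) (n + 1)) (b'.1, Sum.inl b'.2)
                  (wrapPt (towerTorus Lc (fine Lc M) (n + 1)) (((Lc ^ (n + 1 + 1) : ℕ) : ℤ) • yN a'), Sum.inr (μN a')) *
                perF (towerTorus Lc (fine Lc M) (n + 1)) (dper (towerTorus Lc (fine Lc M) (n + 1)) (fun X Z a₀ e₀ => ∑' m₂ : Site (3 + 1),
                  packVH (fun μ y f f' => compVH2Ker (fun _ : ℕ => symLinKerAt (ctr (3 + 1) Lc) Lc) (fun _ : ℕ => symVhKerAt (ctr (3 + 1) Lc) Lc)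
                    (fun (_ : ℕ) μ y g g₁ g₂ => (1 / 2 : ℝ) * (symVh2KerAt (ctr (3 + 1) Lc) Lc μ y g g₁ g₂ + symVh2KerAt (ctr (3 + 1) Lc) Lc μ y g g₂ g₁)) Lc (n + 1 + 1) μ y f
                      (b.2, (b.1 : Site (3 + 1))) f') (Lc ^ (n + 1 + 1)) b'.2 (translate (towerTorus Lc (fine Lc M) (n + 1)) (b'.1 : Site (3 + 1)) m₂) X Z a₀ e₀))
                  (fN (x, κ₀)) ((z, Sum.inl β) : Idx (towerTorus Lc (fine Lc M) (n + 1)) (Fib 3))) := by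
  rw [Qprime2_symm_apply_eq_sigmaFull_mul_sum_sum M n c hc yN μN hv hhvl lv hlv hJW 𝔔₀ h𝔔₀' 𝔔₁f h𝔔₁' 𝔔₂f h𝔔₂' Xbf hXbf 𝔔'₂f h𝔔'₂f r a a' x κ₀ z β]
  refine congrArg (HMul.hMul _) (Finset.sum_congr rfl fun b _ => Finset.sum_congr rfl fun b' _ => ?_)
  rw [tsum₃_sym_packVH_eq_perF_dper_tsum M n fN hfN b b' x κ₀ z β]

end Record

end Summit.QuantumFields.BalabanUV.Beta.FP.TowerQN2RowCopies

end
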